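import Summits.BirchSwinnertonDyer.Rank1Residual.GaloisImage.PropagatedConditionStableRangeThree
import Summits.BirchSwinnertonDyer.Rank1Residual.GaloisImage.LocalTorsionExponentAdditiveThree
import Literature.NumberTheory.EllipticCurves.RootNumberTwistProofs
import Literature.NumberTheory.EllipticCurves.LFunctionSmulProofs
import Literature.NumberTheory.EllipticCurves.VariableChangePointsMap
import Literature.Barriers.BirchSwinnertonDyer.RankNotSumOfLocalInvariantsF3
import Mathlib.NumberTheory.Padics.HeightOneSpectrum
import HarnessLib

/-!
# T-DER-BP with the torsion binder DISCHARGED on every ADDITIVE row: at the place `3` of an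
# elliptic curve `E/ℚ` with additive reduction, `im( H¹(ℚ₃, E[3^{m+1}]) →(3^{m−k}) H¹(ℚ₃, E[3^{k+1}]) )
# = 𝓕_can(E[3^{k+1}])₃` for every `m ≥ k + 2`, and every global class reduces into `𝓕_can` at `3`
# (cell `b2b-bsdres`, team n1011, row T-DER-BP FILE 3b; seat n1011-p13 GEN 11;
# skeleton `cells/n1011/skel/T-DER-BP.md` STATUS v2)

HONEST FRAMING (cell `b2b-bsdres`, run/shared/lean/b2b/bsd-rank1-residual/, verbatim in every
file): the goal of the cell is to DELETE the COMBINATION-SHAPED residual classes of the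
Birch–Swinnerton-Dyer formula for ALL analytic-rank `≤ 1` elliptic curves over `ℚ` — "full BSD
formula for every rank `≤ 1` curve in class `C`" assembled STRICTLY from published theorems — so
that the rank-`≤ 1` remainder becomes exactly the CONSTRUCTION-SHAPED classes, which are TYPED
(missing-input `Prop`s), NOT attempted. This is not "finishing BSD". Team n1011 (X4 ∧ `p = 3`,
§I N11; row T-DER = Kolyvagin's derivative construction behind the route-1 PORT): research route;
TOOL theorems only; no definition, no named fact, no `sorry`; nothing booked; no mark / label / count
moved; closes nothing by itself.

## What

FILE 2 (`PropagatedConditionStableRangeThree`) proved [MR04] Prop. A.2's "in general" clause for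
`E/ℚ` at `p = 3` with the depth EXPLICIT, `m ≥ k + N₀`, under the displayed per-row binder
`hstab : ∀ P : E(ℚ_v), 3^(N₀+1) • P = 0 → 3^N₀ • P = 0`.  FILE 3a (`LocalTorsionExponentAdditiveThree`)
proved `27 • P = 0 → 9 • P = 0` on `X(ℚ₃)` for every `X/ℚ_[3]` with additive reduction.  This file
transports FILE 3a to the cell's currency and removes the binder on the additive rows (ALL of X4):

* `hstab_two_of_hasAdditiveReductionAt` : for `E = W/ℚ` elliptic with `W.HasAdditiveReductionAt v`
  at the place `v` of `3` (`primesEquiv v = 3`), **`3^(2+1) • P = 0 → 3^2 • P = 0` for every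
  `P ∈ E(ℚ_v)`** — i.e. `hstab` holds with `N₀ = 2` (transport along Mathlib's
  `adicCompletion.padicEquiv v : ℚ_v ≃ ℚ_[3]` (`pointEquivOfAlgEquiv`), the change of variables to the
  `ℤ_[3]`-minimal model (`VariableChange.pointEquiv`, `Affine.Point.congrEquiv`), and the tree's
  `hasAdditiveReduction_padic_iff_hasAdditiveReductionAt_ringOfIntegers`);
* **`range_localMap_red_eq_propagatedSelmerStructure_three_of_hasAdditiveReductionAt`** :
  `(localMap r (inr v)).range = propagatedSelmerStructure W 3 k (inr v)` for every `m ≥ k + 2` and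
  every reduction `r : E[3^m·3] → E[3^k·3]` — FILE 2's MAIN with `hstab` discharged;
* `localMap_red_mem_propagatedSelmerStructure_three_of_hasAdditiveReductionAt` (membership form);
* **`localization_map_red_mem_propagatedSelmerStructure_three_of_hasAdditiveReductionAt`** —
  THEOREM B of row T-DER AT `3` ON EVERY ADDITIVE ROW, NO BINDER: for ANY global class
  `c ∈ H¹(ℚ, E[3^m·3])` with `m ≥ k + 2`, `loc₃ (r_* c) ∈ 𝓕_can(E[3^k·3])₃`.  (The T-DER side —
  that Kolyvagin's depth-`3^{k+1}` class is the reduction of the depth-`3^{m+1}` one on `𝒩_{m+1}`,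
  F4 — is NOT claimed here; DICT3's datum on additive rows therefore wants Kolyvagin primes of depth
  `k + 2`, a Chebotarev class inside `𝒫_{k+2} ⊆ 𝒫_k`.)

Existence of a deep enough level is Mazur–Rubin's (Prop. A.2, p. 79, proof p. 80); the explicit
depth `k + 2` on additive rows is THIS FILE's (not in print).

References: B. Mazur, K. Rubin, Mem. AMS 168/799 (2004), App. A Prop. A.2 [MazurRubin2004];
J. H. Silverman, *AEC* VII.6.1 / VII.2.1 / VII.3.1, *ATAEC* IV.9.2 (d) [SilvermanAEC2009,
SilvermanATAEC1994].
-/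

noncomputable section

open scoped Classical NumberField ContRepresentation
open Field NumberField IsDedekindDomain Function
open WeierstrassCurve Literature.NumberTheory.EllipticCurves Literature.NumberTheory.GaloisRepresentations
  Literature.NumberTheory.GaloisRepresentations.DiscreteGaloisModule Rat.HeightOneSpectrum

namespace Summit.BirchSwinnertonDyer.Rank1Residual.GaloisImage

variable (W : WeierstrassCurve ℚ) [W.IsElliptic] {v : HeightOneSpectrum (𝓞 ℚ)}

/-! ### §1. `hstab` with `N₀ = 2` at the place of `3` on an additive row -/

/-- **`3^(2+1) • P = 0 → 3^2 • P = 0` on `E(ℚ_v)` at the place `v` of `3` when `E/ℚ` has ADDITIVE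
reduction at `v`** — T-DER-BP's torsion-stabilisation binder `hstab` with `N₀ = 2`, unconditionally
on the X4 rows: FILE 3a's `LocalTorsionExp3.nine_nsmul_eq_zero_of_hasAdditiveReduction` on the
`ℤ_[3]`-minimal model of `E/ℚ_[3]`, transported along `ℚ_v ≃ ℚ_[3]` and the change of variables.
OURS as assembled (ingredients *AEC* VII.6.1 / VII.2.1 / VII.3.1).
[cite: SilvermanATAEC1994, Cor. IV.9.2(d) with (b) (PDF p. 340)] -/
theorem hstab_two_of_hasAdditiveReductionAt (hv : (primesEquiv v : ℕ) = 3)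
    (hadd : W.HasAdditiveReductionAt v)
    (P : (W.baseChange (v.adicCompletion ℚ)).toAffine.Point) (hP : 3 ^ (2 + 1) • P = 0) :
    3 ^ 2 • P = 0 := by
  haveI := Fact.mk (primesEquiv v).2
  -- additive reduction of the `ℤ_[p]`-minimal model of `E/ℚ_[p]`, `p = primesEquiv v = 3`
  haveI hadd' : ((W.baseChange ℚ_[primesEquiv v]).minimal ℤ_[primesEquiv v]).HasAdditiveReduction
      ℤ_[primesEquiv v] :=
    (W.hasAdditiveReduction_padic_iff_hasAdditiveReductionAt_ringOfIntegers v).mpr hadd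
  haveI : ((W.baseChange ℚ_[primesEquiv v]).minimal ℤ_[primesEquiv v]).IsElliptic :=
    isElliptic_minimal _ _
  -- the points: `E(ℚ_v) ≃+ E(ℚ_[p]) ≃+ X(ℚ_[p])`, `X` the minimal model
  obtain ⟨D, hD⟩ : ∃ D : VariableChange ℚ_[primesEquiv v],
      (W.baseChange ℚ_[primesEquiv v]).minimal ℤ_[primesEquiv v] =
        D • W.baseChange ℚ_[primesEquiv v] := ⟨_, rfl⟩
  let φ : (W.baseChange (v.adicCompletion ℚ)).toAffine.Point ≃+
      ((W.baseChange ℚ_[primesEquiv v]).minimal ℤ_[primesEquiv v]).toAffine.Point :=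
    ((Literature.Barriers.BirchSwinnertonDyer.pointEquivOfAlgEquiv W
        (adicCompletion.padicEquiv v).toAlgEquiv).trans
      (VariableChange.pointEquiv (W.baseChange ℚ_[primesEquiv v]) D)).trans
      (Affine.Point.congrEquiv hD.symm)
  have hQ : 3 ^ (2 + 1) • φ P = 0 := by rw [← map_nsmul, hP, map_zero]
  have key := LocalTorsionExp3.nine_nsmul_eq_zero_of_hasAdditiveReduction hv
    ((W.baseChange ℚ_[primesEquiv v]).minimal ℤ_[primesEquiv v]) (φ P) hQ
  rw [← map_nsmul, EmbeddingLike.map_eq_zero_iff] at key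
  exact key

/-! ### §2. T-DER-BP on additive rows: no binder -/

/-- **`im( H¹(ℚ_v, E[3^m·3]) →(3^{m−k}) H¹(ℚ_v, E[3^k·3]) ) = 𝓕_can(E[3^k·3])_v` at the place `v`
of `3` for every `m ≥ k + 2` and every reduction `r`**, when `E/ℚ` has additive reduction at `3` —
FILE 2's MAIN `range_localMap_red_eq_propagatedSelmerStructure_three` with `hstab` discharged by
`hstab_two_of_hasAdditiveReductionAt`.  Existence of such a depth: Mazur–Rubin Prop. A.2; the
explicit `k + 2` is this file's. [cite: MazurRubin2004, App. A, Prop. A.2 (p. 79) and its proof (p. 80)] -/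
theorem range_localMap_red_eq_propagatedSelmerStructure_three_of_hasAdditiveReductionAt
    (hv : (primesEquiv v : ℕ) = 3) (hadd : W.HasAdditiveReductionAt v)
    (k m : ℕ) (hkm : k + 2 ≤ m)
    (r : (W.torsionGaloisModule (((3 : ℕ) : ℤ) ^ m * ((3 : ℕ) : ℤ))).toContRepresentation →ⁱL
      (W.torsionGaloisModule (((3 : ℕ) : ℤ) ^ k * ((3 : ℕ) : ℤ))).toContRepresentation)
    (hr : ∀ x : geomTorsion W (((3 : ℕ) : ℤ) ^ m * ((3 : ℕ) : ℤ)),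
      ((r x : geomTorsion W (((3 : ℕ) : ℤ) ^ k * ((3 : ℕ) : ℤ))) : geomPoints W) =
        (((3 : ℕ) : ℤ) ^ (m - k)) • (x : geomPoints W)) :
    haveI : Fact (Nat.Prime 3) := ⟨Nat.prime_three⟩
    (DiscreteGaloisModule.localMap r (Sum.inr v : Place ℚ)).range =
      propagatedSelmerStructure W 3 k (Sum.inr v) :=
  range_localMap_red_eq_propagatedSelmerStructure_three W v (N₀ := 2)
    (hstab_two_of_hasAdditiveReductionAt W hv hadd) k m hkm r hr

/-- **Membership form on additive rows**: for `m ≥ k + 2`, EVERY class of `H¹(ℚ_v, E[3^m·3])`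
reduces into `𝓕_can(E[3^k·3])_v` at the place `v` of `3`.
[cite: MazurRubin2004, App. A, Prop. A.2 (p. 79) and its proof (p. 80)] -/
theorem localMap_red_mem_propagatedSelmerStructure_three_of_hasAdditiveReductionAt
    (hv : (primesEquiv v : ℕ) = 3) (hadd : W.HasAdditiveReductionAt v)
    (k m : ℕ) (hkm : k + 2 ≤ m)
    (r : (W.torsionGaloisModule (((3 : ℕ) : ℤ) ^ m * ((3 : ℕ) : ℤ))).toContRepresentation →ⁱL
      (W.torsionGaloisModule (((3 : ℕ) : ℤ) ^ k * ((3 : ℕ) : ℤ))).toContRepresentation)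
    (hr : ∀ x : geomTorsion W (((3 : ℕ) : ℤ) ^ m * ((3 : ℕ) : ℤ)),
      ((r x : geomTorsion W (((3 : ℕ) : ℤ) ^ k * ((3 : ℕ) : ℤ))) : geomPoints W) =
        (((3 : ℕ) : ℤ) ^ (m - k)) • (x : geomPoints W))
    (y : galoisCohomology ((W.torsionGaloisModule (((3 : ℕ) : ℤ) ^ m * ((3 : ℕ) : ℤ))).toLocal
      (Sum.inr v : Place ℚ)) 1) :
    haveI : Fact (Nat.Prime 3) := ⟨Nat.prime_three⟩
    DiscreteGaloisModule.localMap r (Sum.inr v : Place ℚ) y ∈ propagatedSelmerStructure W 3 k (Sum.inr v) :=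
  localMap_red_mem_propagatedSelmerStructure_three W v (N₀ := 2)
    (hstab_two_of_hasAdditiveReductionAt W hv hadd) k m hkm r hr y

/-- **THEOREM B of row T-DER AT THE PLACE `3` ON EVERY ADDITIVE ROW, NO BINDER**: for `E/ℚ` with
additive reduction at `3`, every global class `c ∈ H¹(ℚ, E[3^m·3])` with `m ≥ k + 2` and every
reduction `r : E[3^m·3] → E[3^k·3]`, `loc₃ (r_* c) ∈ 𝓕_can(E[3^k·3])₃`.  NOT claimed: that
Kolyvagin's derivative class of depth `3^{k+1}` IS such a reduction on `𝒩_{m+1}` (the T-DER side,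
F4), nor any other clause of THEOREM B.  Existence of a deep enough level: Mazur–Rubin Prop. A.2;
the explicit depth `k + 2` is this file's. [cite: MazurRubin2004, App. A, Prop. A.2 (p. 79) and its proof (p. 80)] -/
theorem localization_map_red_mem_propagatedSelmerStructure_three_of_hasAdditiveReductionAt
    (hv : (primesEquiv v : ℕ) = 3) (hadd : W.HasAdditiveReductionAt v)
    (k m : ℕ) (hkm : k + 2 ≤ m)
    (r : (W.torsionGaloisModule (((3 : ℕ) : ℤ) ^ m * ((3 : ℕ) : ℤ))).toContRepresentation →ⁱL
      (W.torsionGaloisModule (((3 : ℕ) : ℤ) ^ k * ((3 : ℕ) : ℤ))).toContRepresentation)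
    (hr : ∀ x : geomTorsion W (((3 : ℕ) : ℤ) ^ m * ((3 : ℕ) : ℤ)),
      ((r x : geomTorsion W (((3 : ℕ) : ℤ) ^ k * ((3 : ℕ) : ℤ))) : geomPoints W) =
        (((3 : ℕ) : ℤ) ^ (m - k)) • (x : geomPoints W))
    (c : galoisCohomology (W.torsionGaloisModule (((3 : ℕ) : ℤ) ^ m * ((3 : ℕ) : ℤ))) 1) :
    haveI : Fact (Nat.Prime 3) := ⟨Nat.prime_three⟩
    galoisCohomology.localization (W.torsionGaloisModule (((3 : ℕ) : ℤ) ^ k * ((3 : ℕ) : ℤ)))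
        (Sum.inr v : Place ℚ) 1 (galoisCohomology.map r 1 c) ∈
      propagatedSelmerStructure W 3 k (Sum.inr v) :=
  localization_map_red_mem_propagatedSelmerStructure_three W v (N₀ := 2)
    (hstab_two_of_hasAdditiveReductionAt W hv hadd) k m hkm r hr c

end Summit.BirchSwinnertonDyer.Rank1Residual.GaloisImage

end
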